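import Mathlib

/-!
# The `GL₂` Cartan series of the unramified doubling kernel — closed form (LOCAL SEAM of s23, engine F3 of #28s)

Track B ∕ K2-LIT, hLiu418 = stmt-HodgeConjecture-24832; socket #28s `sig_K2LiuUnramifiedDoublingHeckeIdentity` (U5b ED. 3). Helper (count-neutral,
own head per LEAD R3), PURE ANALYSIS over `ℂ`: the absolutely convergent double series over the Cartan lattice of `GL₂` written
`a = (j + k, j)`, `k ∈ ℕ`, `j ∈ ℤ`,

  `S = ∑_{k ≥ 0, j ∈ ℤ} e_k · ω^j · A^{M⁺(k,j)} · B^{M⁻(k,j)}`,  `M⁺ = (j+k)⁺ + j⁺`, `M⁻ = (j+k)⁻ + j⁻`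

(`e_k` = the eigenvalue of the double coset `K diag(ϖ^k,1) K`, `ω` = the central eigenvalue, `A = χ_w(ϖ) q^{−(s+1)}`, `B = χ_{w̄}(ϖ) q^{−(s+1)}` —
★ #27 `lambdaLoc_iotaLeftLocPi_diagonal_split`, ★ `setIntegral_doubleCoset_mul_left_eq_smul`), satisfies, as soon as the `e_k` obey the `GL₂` Hecke
recursion `e₀ = 1, e₁ = a₁, e₂ = a₁² − (q+1)ω, e_{k+3} = a₁e_{k+2} − qωe_{k+1}` (Tamagawa ∕ Macdonald),

  `S · (1 − a₁A + qωA²) · (ω − a₁B + qB²) = ω · (1 − AB) · (1 − qAB)`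

(target `exists_hasSum_cartanSeriesGL2`, to be appended; THIS instalment = §1 the cone decomposition `exists_coneEquiv` of the index set `ℕ × ℤ` into
three copies of `ℕ × ℕ` and §2 the absolute-convergence lemmas `summable_norm_shift`, `summable_norm_antidiag`): the cleared-denominator form of `c_v(s) = L(s+½, BC(σ_v) ⊗ χ_v) ∕ b_{2,v}(s,χ)` in the statement of #28s
([Li1992, §3 Thm. 3.1]; [GelbartPiatetskishapiroRallis1987, Part A §6]; [Liu2011, §2C (2-4)]; [Macdonald1995, Ch. V §3]). No division by the two
denominators is performed (shifts + the recursion only), so the identity holds on the whole region of absolute convergence (`‖A‖, ‖B‖ ≤ r < 1`,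
`‖ω‖ = 1`, `∑ ‖e_k‖ (k+1) r^k < ∞`; for #28s: every `Re s > 0` by ★ `card_cosets_glIntDet_le_pow_mul`). Theorems only; no `sorry`.
HONEST LABEL: HC_CM is proved only modulo the printed citations (2 remaining named inputs: hLiu418 = stmt-HodgeConjecture-24832, h413 =
stmt-HodgeConjecture-24833) until rung 0 closes; this file is unconditional and moves no counter.
-/

set_option autoImplicit false

set_option linter.dupNamespace false

noncomputable section

namespace Summit.HodgeConjecture.HodgeConjecture.Cruxes.HLiu418.K2LiuCartanSeriesGL2

/-! ## §1 The Cartan lattice of `GL₂` as `ℕ × ℤ`: the three cones -/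

/-- the three cones `j ≥ 0`, `−k ≤ j < 0`, `j < −k` of `ℕ × ℤ` are parametrised by three copies of `ℕ × ℕ`:
`(k, j) ↦ (k, j)`, `(i, l) ↦ (l+i+1, −(i+1))`, `(k, l) ↦ (k, −(k+l+1))`. [cite: Macdonald1995, Ch. V §2] -/
theorem exists_coneEquiv : ∃ E : (ℕ × ℕ) ⊕ (ℕ × ℕ) ⊕ (ℕ × ℕ) ≃ ℕ × ℤ,
    (∀ p : ℕ × ℕ, E (Sum.inl p) = (p.1, (p.2 : ℤ))) ∧
    (∀ p : ℕ × ℕ, E (Sum.inr (Sum.inl p)) = (p.2 + p.1 + 1, -((p.1 : ℤ) + 1))) ∧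
    (∀ p : ℕ × ℕ, E (Sum.inr (Sum.inr p)) = (p.1, -((p.1 : ℤ) + p.2 + 1))) := by
  let f : (ℕ × ℕ) ⊕ (ℕ × ℕ) ⊕ (ℕ × ℕ) → ℕ × ℤ :=
    Sum.elim (fun p => (p.1, (p.2 : ℤ)))
      (Sum.elim (fun p => (p.2 + p.1 + 1, -((p.1 : ℤ) + 1))) (fun p => (p.1, -((p.1 : ℤ) + p.2 + 1))))
  let g : ℕ × ℤ → (ℕ × ℕ) ⊕ (ℕ × ℕ) ⊕ (ℕ × ℕ) := fun p =>
    if 0 ≤ p.2 then Sum.inl (p.1, p.2.toNat)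
      else if 0 ≤ p.2 + p.1 then Sum.inr (Sum.inl ((-p.2 - 1).toNat, (p.2 + p.1).toNat))
      else Sum.inr (Sum.inr (p.1, (-p.2 - p.1 - 1).toNat))
  have hgf : Function.LeftInverse g f := fun x => by
    rcases x with p | p | p
    · simp [f, g]
    · have h1 : ¬ (0 : ℤ) ≤ -((p.1 : ℤ) + 1) := by omega
      have h2 : (0 : ℤ) ≤ -((p.1 : ℤ) + 1) + ((p.2 + p.1 + 1 : ℕ) : ℤ) := by push_cast; omega
      simp only [f, g, Sum.elim_inr, Sum.elim_inl, h1, h2, if_false, if_true]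
      congr 3 <;> omega
    · have h1 : ¬ (0 : ℤ) ≤ -((p.1 : ℤ) + p.2 + 1) := by omega
      have h2 : ¬ (0 : ℤ) ≤ -((p.1 : ℤ) + p.2 + 1) + (p.1 : ℤ) := by omega
      simp only [f, g, Sum.elim_inr, h1, h2, if_false]
      congr 3; omega
  have hfg : Function.RightInverse g f := fun p => by
    rcases p with ⟨k, j⟩
    by_cases h1 : 0 ≤ j
    · simp only [f, g, h1, if_true, Sum.elim_inl, Int.toNat_of_nonneg h1]
    · by_cases h2 : 0 ≤ j + k
      · simp only [f, g, h1, h2, if_false, if_true, Sum.elim_inr, Sum.elim_inl]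
        ext <;> simp only <;> omega
      · simp only [f, g, h1, h2, if_false, Sum.elim_inr]
        ext
        · rfl
        · simp only; omega
  exact ⟨⟨f, g, hgf, hfg⟩, fun p => rfl, fun p => rfl, fun p => rfl⟩

/-! ## §2 Absolute convergence -/

/-- shifted weighted summability: `∑_l ‖e_{l+i}‖ r^l < ∞`. [cite: Macdonald1995, Ch. V §3] -/
theorem summable_norm_shift {e : ℕ → ℂ} {r : ℝ} (hr : 0 < r) (hs : Summable fun k => ‖e k‖ * (k + 1) * r ^ k) (i : ℕ) :
    Summable fun l => ‖e (l + i)‖ * r ^ l := by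
  have h := (summable_nat_add_iff i).2 hs
  refine Summable.of_nonneg_of_le (fun l => by positivity) (fun l => ?_) (h.mul_left (r ^ i)⁻¹)
  have hri : r ^ i ≠ 0 := pow_ne_zero i hr.ne'
  have heq : (r ^ i)⁻¹ * (‖e (l + i)‖ * (((l + i : ℕ) : ℝ) + 1) * r ^ (l + i)) = ‖e (l + i)‖ * (((l + i : ℕ) : ℝ) + 1) * r ^ l := by
    rw [pow_add]; field_simp
  rw [heq]
  have h1 : (1 : ℝ) ≤ ((l + i : ℕ) : ℝ) + 1 := by
    have : (0 : ℝ) ≤ ((l + i : ℕ) : ℝ) := Nat.cast_nonneg _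
    linarith
  calc ‖e (l + i)‖ * r ^ l = ‖e (l + i)‖ * 1 * r ^ l := by ring
    _ ≤ ‖e (l + i)‖ * (((l + i : ℕ) : ℝ) + 1) * r ^ l := by gcongr

/-- antidiagonal summability: `∑_{i,l} ‖e_{l+i+1}‖ r^{l+i+1} < ∞`. [cite: Macdonald1995, Ch. V §3] -/
theorem summable_norm_antidiag {e : ℕ → ℂ} {r : ℝ} (hr : 0 ≤ r) (hs : Summable fun k => ‖e k‖ * (k + 1) * r ^ k) :
    Summable fun p : ℕ × ℕ => ‖e (p.2 + p.1 + 1)‖ * r ^ (p.2 + p.1 + 1) := by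
  -- through `ℕ × ℕ ≃ Σ n, antidiagonal n`, on whose fibres the summand is constant
  have hnn : ∀ p : ℕ × ℕ, 0 ≤ ‖e (p.2 + p.1 + 1)‖ * r ^ (p.2 + p.1 + 1) := fun p => by positivity
  rw [← (Finset.HasAntidiagonal.sigmaAntidiagonalEquivProd (A := ℕ)).summable_iff]
  refine (summable_sigma_of_nonneg fun x => hnn _).2 ⟨fun n => (hasSum_fintype _).summable, ?_⟩
  simp only [Finset.HasAntidiagonal.sigmaAntidiagonalEquivProd_apply]
  have hterm : ∀ n : ℕ, (∑' y : Finset.HasAntidiagonal.antidiagonal n,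
      ‖e ((y : ℕ × ℕ).2 + (y : ℕ × ℕ).1 + 1)‖ * r ^ ((y : ℕ × ℕ).2 + (y : ℕ × ℕ).1 + 1)) = ((n : ℝ) + 1) * (‖e (n + 1)‖ * r ^ (n + 1)) := by
    intro n
    rw [tsum_fintype, Finset.sum_coe_sort (Finset.HasAntidiagonal.antidiagonal n)
      (fun y : ℕ × ℕ => ‖e (y.2 + y.1 + 1)‖ * r ^ (y.2 + y.1 + 1))]
    have hc : ∀ y ∈ Finset.HasAntidiagonal.antidiagonal n, ‖e (y.2 + y.1 + 1)‖ * r ^ (y.2 + y.1 + 1) = ‖e (n + 1)‖ * r ^ (n + 1) := by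
      intro y hy
      rw [Finset.HasAntidiagonal.mem_antidiagonal] at hy
      rw [show y.2 + y.1 + 1 = n + 1 by omega]
    rw [Finset.sum_congr rfl hc, Finset.sum_const, Finset.Nat.card_antidiagonal, nsmul_eq_mul, Nat.cast_add, Nat.cast_one]
  simp only [hterm]
  have h := (summable_nat_add_iff 1).2 hs
  refine Summable.of_nonneg_of_le (fun n => by positivity) (fun n => ?_) h
  have : ((n : ℝ) + 1) ≤ ((n + 1 : ℕ) : ℝ) + 1 := by push_cast; linarith
  calc ((n : ℝ) + 1) * (‖e (n + 1)‖ * r ^ (n + 1)) = ‖e (n + 1)‖ * ((n : ℝ) + 1) * r ^ (n + 1) := by ring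
    _ ≤ ‖e (n + 1)‖ * (((n + 1 : ℕ) : ℝ) + 1) * r ^ (n + 1) := by gcongr

end Summit.HodgeConjecture.HodgeConjecture.Cruxes.HLiu418.K2LiuCartanSeriesGL2

end
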